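import Literature.AlgebraicGeometry.Hyperkaehler.AutZeroAnalytification
import Literature.AlgebraicGeometry.GroupActions.FixedPointSchemeSplitPoints
import HarnessLib

/-!
# Fixed-point schemes split from the fixed-point COUNT on the analytification
# (Conrad–Gabber–Prasad A.8.10 + Serre GAGA §2: the scheme↔analytic end of the fixed-locus transport)

Layer `Literature/AlgebraicGeometry/Hyperkaehler`.  PROOF FILE (theorems only; no definition, no named
fact, nothing posited).  Companion of `AutZeroAnalytification.lean` (`analyticAut hφ δ` = the
biholomorphism of `X^an = M` underlying `δ ∈ Aut X`; `ncard_fixedPoints_analyticAut`: its fixed points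
are in bijection with the `δ(ℂ)`-fixed complex points) and of
`GroupActions/FixedPointSchemeSplitPoints.lean` (a fixed-point scheme of `⟨δ⟩`, `δ` of finite order,
on a smooth `k`-scheme over an algebraically closed field of characteristic `0` with exactly `N ≠ 0`
`δ`-fixed `k`-points `𝟙_ ⟶ X` is `∐_N Spec k`).

* `natCard_unitFixedBy_eq_natCard_algPointsFixedBy` — for any field `k`, `X : SchemeOver k` and
  `δ ∈ Aut X`, the `δ`-fixed rational points in the two models of the base agree in number:
  `#{y : 𝟙_ ⟶ X // y ≫ δ = y} = #{P ∈ X(k) // δ(k) P = P}` (`𝟙_ = (𝟙 : Spec k → Spec k)` versus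
  `specOver k k = (Spec (algebraMap k k))`, equal morphisms; Görtz–Wedhorn I Cor. 3.36 / §(4.1)
  `X(k) = Hom_k(Spec k, X)`);
* `natCard_unitFixedBy_eq_ncard_fixedPoints_analyticAut` — over `ℂ`, with an analytification
  `φ : M → X(ℂ)`: `#{y : 𝟙_ ⟶ X // y ≫ δ = y} = #Fix(analyticAut hφ δ)` (Serre, GAGA §2 Prop. 2:
  `X(ℂ) = X^an` as sets, functorially);
* `exists_fin_isColimit_cofan_of_ncard_fixedPoints_analyticAut_eq` (and the `IsSmoothProjective`
  form `…_of_isSmoothProjective`) — **`X` smooth over `ℂ`, `δ ∈ Aut X` of finite order; if the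
  biholomorphism `analyticAut hφ δ` of `X^an` has exactly `N ≠ 0` fixed points, then EVERY fixed-point
  scheme `j : F ⟶ X` of `⟨δ⟩` is the coproduct of `N` copies of `𝟙_ = Spec ℂ`**:
  `∃ x : Fin N → (𝟙_ ⟶ F)`, injective, `Nonempty (IsColimit (Cofan.mk F x))`.

CONSUMER (cell `hodge-kum4`, ladder HodgeAV rung H3): with `N = 125`, `X` smooth projective of
`Kum⁴`-type and `δ ∈ Γ(X) ∖ 1` this is the inner conclusion of the PRINT-SYNTHESIS fact
`HassettTschinkel2013_Oguiso2020_fixedPointScheme_translation_kum4Type` (F125X), so that its kernel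
derivation needs exactly the ANALYTIC count «every order-`5` element of `Aut°(X^an)` (equivalently
`analyticAut δ`, `δ ∈ Γ(X) ∖ 1`) has `125` fixed points» — the one-family transport
`Geometry.Hyperkaehler.HassettTschinkel2013_holAutZero_localSystem.forall_orderOf_ncard_fixedPoints_iff`
(modulo the HT13 fact and the IHS-chain hypothesis) — and nothing scheme-theoretic.  Nothing here
concerns the Hodge conjecture; no rung word changes.

## References
* [SerreGAGA1956] J.-P. Serre, *Géométrie algébrique et géométrie analytique*, Ann. Inst. Fourier 6
  (1956), §2 Prop. 2 (functoriality of `X ↦ X^h` on points and morphisms).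
* [ConradGabberPrasad2015] B. Conrad, O. Gabber, G. Prasad, *Pseudo-reductive groups* (2nd ed.),
  Prop. A.8.10 (1)–(2).
* [GortzWedhorn2020] U. Görtz, T. Wedhorn, *Algebraic Geometry I* (2nd ed.), Cor. 3.36, §(4.1), Prop. 5.20.
-/

set_option autoImplicit false

noncomputable section

open CategoryTheory CategoryTheory.Limits AlgebraicGeometry MonoidalCategory
open Literature.AlgebraicGeometry.Motives (SchemeOver ComplexPoints IsSmoothProjective AlgPoints specOver)
open Literature.AlgebraicGeometry.GroupActions
open Literature.NumberTheory.Transcendental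

namespace Literature.AlgebraicGeometry.Hyperkaehler

/-! ### Rational points: `𝟙_ ⟶ X` versus `X(k) = (specOver k k ⟶ X)` -/

section Field

variable {k : Type} [Field k] {X : SchemeOver k}

/-- The structure morphism of `specOver k k` is the identity of `Spec k` (plumbing). [folklore] -/
private theorem specOver_self_hom : (specOver k k).hom = 𝟙 (Spec (CommRingCat.of k)) := by
  simp only [specOver, Over.mk_hom, Algebra.algebraMap_self, CommRingCat.ofHom_id, Spec.map_id]

/-- **`#{y : 𝟙_ ⟶ X // y ≫ δ = y} = #{P ∈ X(k) // δ(k) P = P}`**: the `δ`-fixed rational points of a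
`k`-scheme `X`, counted as morphisms from the monoidal unit `𝟙_ = (𝟙 : Spec k → Spec k)` or as
`k`-points `X(k) = Hom_k(Spec k, X)` (the tree's `AlgPoints X k`, source `specOver k k`), agree — the
two sources have the same underlying scheme and structure map.
[cite: GortzWedhorn2020, Cor. 3.36 and §(4.1)] -/
theorem natCard_unitFixedBy_eq_natCard_algPointsFixedBy (δ : Aut X) :
    Nat.card {y : 𝟙_ (SchemeOver k) ⟶ X // y ≫ δ.hom = y} =
      Nat.card {P : AlgPoints X k // AlgPoints.map δ.hom P = P} := by
  -- the two models of a rational point have the same underlying morphism `Spec k ⟶ X`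
  let e : (𝟙_ (SchemeOver k) ⟶ X) ≃ AlgPoints X k :=
    { toFun := fun y => AlgPoints.mk y.left (by
        change y.left ≫ X.hom = (specOver k k).hom
        rw [specOver_self_hom]
        exact Over.w y)
      invFun := fun P => Over.homMk P.left ((Over.w P).trans specOver_self_hom)
      left_inv := fun y => by ext; rfl
      right_inv := fun P => by ext; rfl }
  refine Nat.card_congr (e.subtypeEquiv fun y => ?_)
  change y ≫ δ.hom = y ↔ e y ≫ δ.hom = e y
  constructor
  · intro h
    apply Over.OverMorphism.ext
    change y.left ≫ δ.hom.left = y.left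
    rw [← Over.comp_left, h]
  · intro h
    apply Over.OverMorphism.ext
    change y.left ≫ δ.hom.left = y.left
    have h' := congrArg CommaMorphism.left h
    simp only [Over.comp_left] at h'
    exact h'

/-- The same as a `Set.ncard` of the fixed-point SET in `X(k)`. [cite: GortzWedhorn2020, Cor. 3.36 and §(4.1)] -/
theorem natCard_unitFixedBy_eq_ncard_algPointsFixedBy (δ : Aut X) :
    Nat.card {y : 𝟙_ (SchemeOver k) ⟶ X // y ≫ δ.hom = y} =
      {P : AlgPoints X k | AlgPoints.map δ.hom P = P}.ncard := by
  rw [natCard_unitFixedBy_eq_natCard_algPointsFixedBy, ← Nat.card_coe_set_eq]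
  rfl

end Field

/-! ### Over `ℂ`: the count on the analytification -/

section Complex

variable {n : ℕ} {X : SchemeOver ℂ}
  {E : Type} [NormedAddCommGroup E] [NormedSpace ℂ E] [FiniteDimensional ℂ E]
  {M : Type} [TopologicalSpace M] [ChartedSpace E M] {φ : M → ComplexPoints X}

/-- **`#{y : 𝟙_ ⟶ X // y ≫ δ = y} = #Fix(analyticAut δ)`** for an analytification `φ : M → X(ℂ)`
(Serre, GAGA §2 Prop. 2: `φ` is a bijection intertwining `analyticAut hφ δ` and `δ(ℂ)`; tree
`ncard_fixedPoints_analyticAut`).  `Set.ncard` is `0` on infinite sets, as is `Nat.card`.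
[cite: SerreGAGA1956, §2 Prop. 2] -/
theorem natCard_unitFixedBy_eq_ncard_fixedPoints_analyticAut (hφ : IsAnalytification E X n φ)
    (δ : Aut X) :
    Nat.card {y : 𝟙_ (SchemeOver ℂ) ⟶ X // y ≫ δ.hom = y} = {x : M | analyticAut hφ δ x = x}.ncard := by
  rw [ncard_fixedPoints_analyticAut, natCard_unitFixedBy_eq_ncard_algPointsFixedBy]

/-- **Fixed-point schemes split from the analytic count.**  `X` smooth over `ℂ` with an
analytification `φ : M → X(ℂ)`, `δ ∈ Aut X` of finite order: if the biholomorphism `analyticAut hφ δ`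
of `M = X^an` has exactly `N ≠ 0` fixed points, then every fixed-point scheme `j : F ⟶ X` of the
cyclic group `⟨δ⟩ ≤ Aut X` is the coproduct of `N` copies of `𝟙_ = Spec ℂ` along an injective
enumeration `x : Fin N → (𝟙_ ⟶ F)` of its `ℂ`-points — "`X^δ` is `N` reduced points"
(Conrad–Gabber–Prasad A.8.10: `F` is smooth, hence reduced, with `N` `ℂ`-points; Serre GAGA §2 for
the count).  [cite: ConradGabberPrasad2015, Prop. A.8.10(1)–(2)] [cite: SerreGAGA1956, §2 Prop. 2]
[cite: GortzWedhorn2020, Cor. 3.36 and Prop. 5.20] -/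
theorem exists_fin_isColimit_cofan_of_ncard_fixedPoints_analyticAut_eq [Smooth X.hom]
    (hφ : IsAnalytification E X n φ) (δ : Aut X) (hδ : IsOfFinOrder δ) {N : ℕ} (hN0 : N ≠ 0)
    (hN : {x : M | analyticAut hφ δ x = x}.ncard = N)
    ⦃F : SchemeOver ℂ⦄ (j : F ⟶ X) (hF : IsFixedPointScheme (Subgroup.zpowers δ).subtype j) :
    ∃ x : Fin N → (𝟙_ (SchemeOver ℂ) ⟶ F),
      Function.Injective x ∧ Nonempty (IsColimit (Cofan.mk F x)) := by
  rw [← natCard_unitFixedBy_eq_ncard_fixedPoints_analyticAut hφ] at hN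
  exact exists_fin_isColimit_cofan_of_isOfFinOrder δ hδ hN0 hN j hF

/-- The same for `X` smooth projective of dimension `n` (the token `IsSmoothProjective n X` of the
`Kumⁿ`-type records).  For `n = 8`, `X` of `Kum⁴`-type, `δ ∈ Γ(X) ∖ 1` and `N = 125` the conclusion is
that of `HassettTschinkel2013_Oguiso2020_fixedPointScheme_translation_kum4Type`, obtained from the
count of the fixed points of `analyticAut δ` on `X^an` alone.
[cite: ConradGabberPrasad2015, Prop. A.8.10(1)–(2)] [cite: SerreGAGA1956, §2 Prop. 2] -/
theorem exists_fin_isColimit_cofan_of_isSmoothProjective (hX : IsSmoothProjective n X)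
    (hφ : IsAnalytification E X n φ) (δ : Aut X) (hδ : IsOfFinOrder δ) {N : ℕ} (hN0 : N ≠ 0)
    (hN : {x : M | analyticAut hφ δ x = x}.ncard = N)
    ⦃F : SchemeOver ℂ⦄ (j : F ⟶ X) (hF : IsFixedPointScheme (Subgroup.zpowers δ).subtype j) :
    ∃ x : Fin N → (𝟙_ (SchemeOver ℂ) ⟶ F),
      Function.Injective x ∧ Nonempty (IsColimit (Cofan.mk F x)) :=
  haveI : Smooth X.hom := hX.smoothOfRelativeDimension.smooth
  exists_fin_isColimit_cofan_of_ncard_fixedPoints_analyticAut_eq hφ δ hδ hN0 hN j hF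

end Complex

end Literature.AlgebraicGeometry.Hyperkaehler

end
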